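import Literature.AlgebraicGeometry.Motives.HodgeLieWeightOneSl2CenterCornerDimension
import HarnessLib

/-!
# Weight-one Hodge structures whose Hodge Lie algebra has a three-dimensional derived algebra and ARBITRARY centre.
# G: the structure theorem read on `End_Hdg(V)` alone — the central projector `p` onto the `𝔰𝔩₂`-part

Family `hodge`, layer `Literature/AlgebraicGeometry/Motives`; THEOREMS ONLY (no definition, no named fact; D-0026).
Seventh and last abstract file of the lane MT-RANK-SIX-ISOGENY of the cell `pub-hodgecm2` (COR-CM), seat `b27`,
generalising the lane MT-RANK-FIVE (`Motives/HodgeLieWeightOneRankFourRange`, centre of dimension `1`) to a centre of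
any dimension.

* **`exists_central_projector_of_finrank_derived_eq_three`** — for a polarizable EFFECTIVE `ℚ`-Hodge structure `H` of
  weight `1` with Hodge Lie algebra `𝔥 = Lie Hg(H) ⊄ End_Hdg(V)` (not of CM type), centre `𝔷 = 𝔥 ∩ End_Hdg(V)` and
  derived algebra `𝔡 = span_ℚ {[X₁, X₂] | Xᵢ ∈ 𝔥}` of dimension `3`, there is a Hodge endomorphism `p` with:
  `p² = p ≠ 0`; `p` commutes with `End_Hdg(V)` and is `ψ`-symmetric; `D p = D = p D` for `D ∈ 𝔡` and `Z p = 0` for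
  `Z ∈ 𝔷` (the Hodge Lie algebra acts on `pV` through `𝔡 ≅ 𝔰𝔩₂` and on `(1 − p)V` through `𝔷`); `p = 1 ↔ 𝔷 = 0`;
  `4 · dim_ℚ {a ∈ End_Hdg | a p = a} = (rk p)²` and the centre of this corner is `ℚ p`; and a rational endomorphism
  supported on `ker p` is a Hodge endomorphism as soon as it commutes with `𝔷`.
  Everything else (`P`, `E`, `F`, `α`, `ζ₀`, `π`, the graded basis) is internal.

Geometric reading (`Summits/HodgeConjecture/CorCM/MumfordTateRankSix*`): for a complex abelian variety `X` not of
CM type with `dim MT(H¹X) ≤ 6`, `p = e^*` for a central idempotent `e ∈ End⁰(X)`, `X ∼ eX × (1−e)X` with `eX ∼ B^{m+1}`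
(`B` a non-CM elliptic curve or a quaternion surface) and `(1−e)X` of CM type (Moonen–Zarhin 1999 §2 in dimension
`≤ 5`).

## References

* [MoonenZarhin1999LowDim] B. Moonen, Yu. Zarhin, *Hodge classes on abelian varieties of low dimension*, Math. Ann. 315
  (1999), §2.
* [Deligne1982HodgeCycles] P. Deligne, *Hodge cycles on abelian varieties*, LNM 900 (1982), I §3 (3.1–3.7), Ex. 3.7.
* [Zarhin1983HodgeGroupsK3] Yu. G. Zarhin, *Hodge groups of K3 surfaces*, J. reine angew. Math. 341 (1983), §2.
-/

noncomputable section

open scoped TensorProduct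

namespace Literature.AlgebraicGeometry.Motives

universe u

namespace HodgeStructure

open ProjectorBlocks Literature.RepresentationTheory.GeneralLinear

variable {V : Type u} [AddCommGroup V] [Module ℚ V] [Module.Finite ℚ V] [HodgeTensorFacts.{u, u}] {n : ℤ}

/-! ## §10 The structure theorem on `End_Hdg(V)` -/

omit [Module.Finite ℚ V] [HodgeTensorFacts.{u, u}] in
/-- `(⊥)_ℂ = ⊥`. [cite: Deligne1982HodgeCycles, I §3 (proof of Prop. 3.4)] -/
theorem spanC_bot : spanC (⊥ : Submodule ℚ (Module.End ℚ V)) = ⊥ := by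
  unfold spanC
  rw [Submodule.span_eq_bot]
  rintro _ ⟨Z, hZ, rfl⟩
  rw [SetLike.mem_coe, Submodule.mem_bot] at hZ
  change Z.baseChange ℂ = 0
  rw [hZ, LinearMap.baseChange_zero]

/-- **Structure of a polarizable weight-one Hodge structure whose Hodge Lie algebra has a three-dimensional derived
algebra, read on `End_Hdg(V)`** (basis-free; see the module docstring).  Assembly of `exists_rat_projector`,
`center_mul_projector_eq_zero`, `four_mul_finrank_corner_eq_sq`, `exists_eq_smul_of_mem_center_corner` and
`mem_endAlg_of_mul_projector_eq_zero` in a graded basis adapted to `H` (`exists_basis_F_eq_span`).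
[cite: MoonenZarhin1999LowDim, §2] [cite: Deligne1982HodgeCycles, I §3 (3.1–3.7) and Ex. 3.7]
[cite: Zarhin1983HodgeGroupsK3, §2] -/
theorem exists_central_projector_of_finrank_derived_eq_three (H : HodgeStructure V n) (ψ : H.Polarization)
    (hn : n = 1) (heff : H.IsEffective) (hne : ¬ H.hodgeLie ≤ Subalgebra.toSubmodule H.endAlg)
    (h3 : Module.finrank ℚ ↥(Submodule.span ℚ {B | ∃ X ∈ H.hodgeLie, ∃ Y ∈ H.hodgeLie, X * Y - Y * X = B}) = 3) :
    ∃ p : Module.End ℚ V, p ∈ H.endAlg ∧ p * p = p ∧ p ≠ 0 ∧ (∀ a ∈ H.endAlg, a * p = p * a) ∧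
      (∀ v w, ψ.form (p v) w = ψ.form v (p w)) ∧
      (∀ D ∈ Submodule.span ℚ {B | ∃ X ∈ H.hodgeLie, ∃ Y ∈ H.hodgeLie, X * Y - Y * X = B}, D * p = D ∧ p * D = D) ∧
      (∀ Z ∈ H.hodgeLie ⊓ Subalgebra.toSubmodule H.endAlg, Z * p = 0) ∧
      (p = 1 ↔ H.hodgeLie ⊓ Subalgebra.toSubmodule H.endAlg = ⊥) ∧
      4 * Module.finrank ℚ ↥(Subalgebra.toSubmodule H.endAlg ⊓
          LinearMap.ker (LinearMap.mulRight ℚ p - LinearMap.id)) = Module.finrank ℚ (LinearMap.range p) ^ 2 ∧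
      (∀ z ∈ H.endAlg, z * p = z → (∀ a ∈ H.endAlg, a * p = a → z * a = a * z) → ∃ c : ℚ, z = c • p) ∧
      (∀ a : Module.End ℚ V, a * p = 0 → p * a = 0 →
        (∀ Z ∈ H.hodgeLie ⊓ Subalgebra.toSubmodule H.endAlg, a * Z = Z * a) → a ∈ H.endAlg) := by
  classical
  obtain ⟨X, hX, hXE⟩ := SetLike.not_le_iff_exists.1 hne
  rw [Subalgebra.mem_toSubmodule] at hXE
  obtain ⟨S, deg, e, hF, hFc⟩ := exists_basis_F_eq_span H
  haveI : Fintype S := FiniteDimensional.fintypeBasisIndex e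
  have hdeg : ∀ σ, deg σ = 0 ∨ deg σ = 1 := fun σ => by
    have h := heff.deg_mem_Icc_of_graded e hF hFc σ
    omega
  subst hn
  obtain ⟨α, ζ₀, hα, hζ₀, hEF⟩ := exists_commutator_eq_of_finrank_derived_eq_three H ψ rfl heff e hF hFc hdeg hX hXE h3
  obtain ⟨p, hpQ, hpp, hp0, -, hpA, -, hpc, hDp, hpsymm⟩ :=
    exists_rat_projector H ψ rfl heff e hF hFc hdeg hX hXE h3 hα hζ₀ hEF rfl
  have hZp : ∀ Z ∈ H.hodgeLie ⊓ Subalgebra.toSubmodule H.endAlg, Z * p = 0 := fun Z hZ =>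
    center_mul_projector_eq_zero H ψ rfl e hF hFc hdeg hX hXE h3 hα hζ₀ hEF rfl hpQ hp0 hpsymm
      (Submodule.mem_inf.1 hZ).1 (Submodule.mem_inf.1 hZ).2
  refine ⟨p, hpA, hpp, hp0, hpc, hpsymm, hDp, hZp, ?_, ?_, ?_, ?_⟩
  · -- `p = 1 ↔ 𝔷 = 0`
    constructor
    · intro hp1
      rw [Submodule.eq_bot_iff]
      intro Z hZ
      rw [← mul_one Z, ← hp1]
      exact hZp Z hZ
    · intro hbot
      rw [hbot, spanC_bot, Submodule.mem_bot] at hζ₀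
      obtain ⟨-, -, -, -, -, -, -, -, -, -, hQ1, -, -⟩ := projector_identities H rfl e hF hFc hdeg hX hα
        (by rw [hbot, spanC_bot, Submodule.mem_bot] : (0 : Module.End ℂ (ℂ ⊗[ℚ] V)) ∈ _) (by rw [hEF, hζ₀]) rfl
      rw [zero_mul, smul_zero, add_zero] at hQ1
      apply eq_of_sub_eq_zero
      apply eq_zero_of_baseChange_eq_zero
      rw [LinearMap.baseChange_sub, hpQ, hQ1, Module.End.one_eq_id, Module.End.one_eq_id, LinearMap.baseChange_id,
        sub_self]
  · exact four_mul_finrank_corner_eq_sq H ψ rfl e hF hFc hdeg hX hXE h3 hα hζ₀ hEF rfl hpQ hpp hpA hpc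
  · intro z hzA hzp hzc
    exact exists_eq_smul_of_mem_center_corner H ψ rfl e hF hFc hdeg hX hXE h3 hα hζ₀ hEF rfl hpQ hpp hp0 hpc hzA hzp hzc
  · intro a hap hpa haZ
    exact mem_endAlg_of_mul_projector_eq_zero H rfl e hF hFc hdeg hX hα hζ₀ hEF rfl hpQ hap hpa haZ

end HodgeStructure

end Literature.AlgebraicGeometry.Motives

end
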